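import Literature.AlgebraicGeometry.Motives.HodgeThetaSubalgebraUnitaryRaisingSpaceDimension
import Literature.AlgebraicGeometry.Motives.HodgeThetaSubalgebraUnitaryFourteenFifteenCore
import HarnessLib

/-!
# The `Θ`-subalgebra theorem for unitary multiplicities `(9, 10)` — the `p = 19` cell, closed classification-free by
# the raising-space dimension of the two Levi algebras (Ribet 1983 Thm. 3, Lie step; abelian 19-folds of type `(9, 10)`)

Family `hodge`, layer `Literature/AlgebraicGeometry/Motives` (pure linear algebra over `ℂ`; no geometry). Research
context: cell `pub-hodge-ring2` (HONEST FRAMING: research route conditional on HC_CM; not a corollary; Q11.4-sentence-2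
already refuted in dim ≥ 3), Literature lane gen 87, programme R75. UNCONDITIONAL; theorems only, no definition, no
named fact (D-0026), no `sorry`.

THE PRINT. K. A. Ribet, Amer. J. Math. 105 (1983), Thm. 3 = Gordon's survey Thm. 6.3 (3) [held
`paper:arxiv-alg-geom_9709030` p. 18]: `End⁰ = k` imaginary quadratic acting with coprime multiplicities `(n′, n″)` ⟹
`Hg = U(V, φ)`, `B•(Xⁿ) = D•(Xⁿ)`. The lane replaces Ribet's appeal to the classification of minuscule representations
pair by pair; `(9, 10)` was the last open pair with `n′ + n″ ≤ 29` prime (lit-g85/86 READMEs: «the prize»; every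
local Levi analysis is consistent there).

THE SETTING is that of the tree's unitary cores: `𝔊 ⊆ End_ℂ(W)` bracket-closed and irreducible, an involution
`Θ ∈ 𝔊` with eigenspaces `P`, `Q` (`dim P = 9`, `dim Q = 10`), a Hermitian pairing `s` with `P ⊥ Q`, definite on `P`
and on `Q`, for which `𝔊` is adjoint-closed. For a raising `B` of rank `r` the Levi pair
(`UnitaryLeviSetup.exists_levi_pair`) consists of the concrete Levi algebras `L⁺` on `U⁺` (type `(9 − r | r)`) and `L⁻`
on `U⁻` (type `(r | 10 − r)`); a raising `X` commuting with the involution `ι` of `B` has profile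
`(i, j) = (rk X|_{U⁺}, rk X|_{U⁻})`, `rk X = i + j`.

* §1 Devices: a raising operator of prescribed rank in any graded space (`UnitaryRaisingSpace.exists_raise_le_finrank_range`),
  lifts recording their values (`UnitaryLeviSetup.exists_lift_eq`), a rank-one lift and a lift of large `U⁺`-rank through
  a full `L⁺` (`exists_lift_rankOne`, `exists_lift_le_finrank`).
* §2 If `𝔊 ≠ End(W)` the ranks `1, 3, 7, 9` are absent (larger-side Levi types `(1|9)`, `(3|7)`, `(7|3)`, `(9|1)` are tree
  cores, `UnitaryDoubleLevi.eq_top_of_raise_of_core`) and `8` raises to `9`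
  (`UnitaryRaisingRank.exists_raise_rank_gt_of_finrank_eq_succ_of_smul`, `2(9 − ρ) ≠ 8ρ`), so `S ⊆ {0, 2, 4, 5, 6}`.
  (G1) `no_rank_two`: `L⁺` of type `(7|2)` is full (`UnitaryTwoOdd.eq_top'`); a rank-one lift has profile `(1, 1)`, so
  `L⁻` of type `(2|8)` is full (`UnitaryRankOneRaise.eq_top_of_rankOne_raise_two`) — impossible on the larger side.
  (G2), (G3) `no_rank_four`, `no_rank_five` (ranks in `{0, 4, 5, 6}`): `L⁺` of type `(5|4)` resp. `(4|5)` is full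
  (`UnitaryCoprimeStep.eq_top_five_four` / `eq_top_four_five`); lifts `X₄` (`i ≥ 4`) and `X₁` (`i = 1`, hence `j ≥ 3`)
  give by two pencils (`UnitaryGenericRank.exists_finrank_le_and_finrank_le`) a raising operator of rank `≥ 7 > 6`.
* §3 (G4) `false_of_rank_zero_or_six` — THE CONSTANT-RANK STALL. At a rank-`6` `B` (`L⁺` of type `(3|6)`, `L⁻` of type
  `(6|4)`): profiles `(0,0)`, `(2,4)`, `(3,3)` (`i = 1` killed by the maximality polarisation
  `UnitaryLeviFull.exists_rankOne_raise_of_maxRank`); `(2,4)` and `(3,3)` do not coexist (two pencils); `(2,4)` alone: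
  `L⁺` has constant raising rank `2`, impossible (TOOL B `UnitaryThree.exists_raise_rank_ne_two`); `(3,3)` alone: both
  Levi algebras have constant raising rank `3`, so `L⁺` has at most two independent raising operators
  (`UnitaryConstantRank.exists_pair_span_raise`) and `L⁻` at least three
  (`UnitaryConstantRank.exists_three_raise_linearIndependent`); lifting the three to raising operators of `𝔊` commuting
  with `ι` and restricting to `U⁺` yields a non-trivial relation `Σ gₖ Xₖ|_{U⁺} = 0`; the profile of `Σ gₖ Xₖ` is then
  `(0, 0)`, so `Σ gₖ Xₖ|_{U⁻} = Σ gₖ Aₖ = 0` — contradicting independence.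
* §4 **`UnitaryNineTen.eq_top_of_smul`** and the mirror `eq_top_of_smul'` (`(10, 9)`).

CONSEQUENCES (sequels): Ribet's theorem at `(n′, n″) = (9, 10)` (`HodgeTheory/RibetTypeNineTenPowersHodgeClasses`):
EVERY simple complex abelian `19`-fold with `End⁰ ≠ ℚ` satisfies `B• = D•` on all powers; the `p = 31` cell `{12, 19}`
(`HodgeThetaSubalgebraUnitaryTwelveNineteenCore`, whose residual is a `(9|10)` Levi algebra of constant raising rank `6`).

## References
* [Ribet1983] K. A. Ribet, *Hodge classes on certain types of abelian varieties*, Amer. J. Math. 105 (1983), Thm. 3.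
* [Gordon1997] B. B. Gordon, *A survey of the Hodge conjecture for abelian varieties*, Thm. 6.3 (3), pp. 18–19.
* [Deligne1982HodgeCycles] P. Deligne, *Hodge cycles on abelian varieties*, LNM 900 (1982), I §3 Prop. 3.4, 3.6.
* [GoodmanWallachGTM255] R. Goodman, N. R. Wallach, GTM 255 (2009), §4.1.1.
* [HoffmanKunze1971LinearAlgebra] K. Hoffman, R. Kunze, *Linear Algebra* (1971), §3.1 Thm. 2, §6.7, §8.3.
-/

noncomputable section

open Module

namespace Literature.AlgebraicGeometry.Motives

namespace HodgeStructure

universe u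

variable {W : Type u} [AddCommGroup W] [Module ℂ W]

/-! ### §1 Raising operators of prescribed rank; lifts with their values -/

/-- In a finite-dimensional space with an involution `ι` (eigenspaces `P'`, `Q'`), for `k ≤ dim P'`, `k ≤ dim Q'` there
is a raising operator `T` (`ιT = T = −Tι`) of rank `≥ k` (send `k` basis vectors of `Q'` to `k` basis vectors of `P'`).
[cite: HoffmanKunze1971LinearAlgebra, §3.1 Thm. 2, §6.7] -/
theorem UnitaryRaisingSpace.exists_raise_le_finrank_range {U : Type*} [AddCommGroup U] [Module ℂ U]
    [FiniteDimensional ℂ U] {ι : Module.End ℂ U} (hιι : ι * ι = 1) {P' Q' : Submodule ℂ U}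
    (hP' : ∀ x, x ∈ P' ↔ ι x = x) (hQ' : ∀ x, x ∈ Q' ↔ ι x = -x) {k : ℕ} (hkP : k ≤ Module.finrank ℂ P')
    (hkQ : k ≤ Module.finrank ℂ Q') :
    ∃ T : Module.End ℂ U, ι * T = T ∧ T * ι = -T ∧ k ≤ Module.finrank ℂ (LinearMap.range T) := by
  classical
  have hιv : ∀ v, ι (ι v) = v := fun v => by rw [← Module.End.mul_apply, hιι, Module.End.one_apply]
  set bP := Module.finBasis ℂ P' with hbPdef
  set bQ := Module.finBasis ℂ Q' with hbQdef
  -- the projection onto `Q'`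
  have hπmem : ∀ u : U, ((2 : ℂ)⁻¹ • (1 - ι)) u ∈ Q' := fun u => (hQ' _).2 (by
    simp only [LinearMap.smul_apply, LinearMap.sub_apply, Module.End.one_apply, map_smul, map_sub, hιv]
    rw [← smul_neg, neg_sub])
  set π : U →ₗ[ℂ] Q' := LinearMap.codRestrict Q' ((2 : ℂ)⁻¹ • (1 - ι)) hπmem with hπdef
  have hπval : ∀ u : U, ((π u : Q') : U) = (2 : ℂ)⁻¹ • (u - ι u) := fun u => by
    simp only [hπdef, LinearMap.codRestrict_apply, LinearMap.smul_apply, LinearMap.sub_apply, Module.End.one_apply]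
  have hπQ : ∀ q : Q', π (q : U) = q := fun q => Subtype.ext (by
    rw [hπval, (hQ' _).1 q.2]; module)
  have hπι : ∀ u : U, π (ι u) = -π u := fun u => Subtype.ext (by
    rw [hπval, Submodule.coe_neg, hπval, hιv]; module)
  -- the images
  set g : Fin (Module.finrank ℂ Q') → U := fun i =>
    if h : (i : ℕ) < k then ((bP (Fin.castLE hkP ⟨i, h⟩) : P') : U) else 0 with hgdef
  have hgP : ∀ i, ι (g i) = g i := fun i => by
    by_cases h : (i : ℕ) < k
    · rw [hgdef]; simp only [h, dite_true]; exact (hP' _).1 (bP _).2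
    · rw [hgdef]; simp only [h, dite_false, map_zero]
  set T : Module.End ℂ U := (bQ.constr ℂ g) ∘ₗ π with hTdef
  have hTapply : ∀ u, T u = bQ.constr ℂ g (π u) := fun u => rfl
  refine ⟨T, LinearMap.ext fun u => ?_, LinearMap.ext fun u => ?_, ?_⟩
  · rw [Module.End.mul_apply, hTapply, Basis.constr_apply_fintype, map_sum]
    refine Finset.sum_congr rfl fun i _ => ?_
    rw [map_smul, hgP]
  · rw [Module.End.mul_apply, LinearMap.neg_apply, hTapply, hTapply, hπι, map_neg]
  · -- the `k` vectors `bP (castLE l)` are independent values of `T`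
    set e : Fin k → U := fun l => ((bP (Fin.castLE hkP l) : P') : U) with hedef
    have he : LinearIndependent ℂ e := by
      have h1 : LinearIndependent ℂ (fun l : Fin k => bP (Fin.castLE hkP l)) :=
        bP.linearIndependent.comp _ (Fin.castLE_injective hkP)
      exact h1.map' P'.subtype (Submodule.ker_subtype P')
    have hTe : ∀ l : Fin k, T ((bQ (Fin.castLE hkQ l) : Q') : U) = e l := fun l => by
      rw [hTapply, hπQ, Basis.constr_basis, hgdef]
      simp only [Fin.val_castLE, Fin.is_lt, dite_true, hedef, Fin.eta]
    have hle : Submodule.span ℂ (Set.range e) ≤ LinearMap.range T := by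
      rw [Submodule.span_le]
      rintro _ ⟨l, rfl⟩
      exact ⟨_, hTe l⟩
    have h := Submodule.finrank_mono hle
    rw [finrank_span_eq_card he, Fintype.card_fin] at h
    exact h

/-- A raising element `A` of the Levi algebra on `U` is the restriction of a raising `X ∈ 𝔊` commuting with `ι`, with
the same values on `U` (`UnitaryLeviLift.exists_raise_restrict`; the tree's `UnitaryLeviSetup.exists_lift` records only
the rank). [cite: GoodmanWallachGTM255, §4.1.1] [cite: Deligne1982HodgeCycles, I §3 Prop. 3.4] -/
theorem UnitaryLeviSetup.exists_lift_eq {𝔊 : Submodule ℂ (Module.End ℂ W)}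
    (hbr : ∀ Y ∈ 𝔊, ∀ Z ∈ 𝔊, Y * Z - Z * Y ∈ 𝔊) {Θ : Module.End ℂ W} (hΘ : Θ ∈ 𝔊) (hΘΘ : Θ * Θ = 1)
    {ι : Module.End ℂ W} {U : Submodule ℂ W} {L : Submodule ℂ (Module.End ℂ U)} {ιU : Module.End ℂ U}
    (hιΘ : ι * Θ = Θ * ι) (hL : ∀ A, A ∈ L ↔ ∃ Z ∈ 𝔊, Z * ι = ι * Z ∧ ∀ x : U, ((A x : U) : W) = Z x)
    (hιU : ∀ x : U, ((ιU x : U) : W) = Θ x) (A : Module.End ℂ U) (hA : A ∈ L) (hιA : ιU * A = A)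
    (hAι : A * ιU = -A) :
    ∃ X ∈ 𝔊, Θ * X = X ∧ X * Θ = -X ∧ X * ι = ι * X ∧ ∀ v : U, X v = ((A v : U) : W) := by
  obtain ⟨Z, hZ, hZc, hAZ⟩ := (hL A).1 hA
  have hZ1 : ∀ u ∈ U, Θ (Z u) = Z u := fun u hu => by
    have h := congrArg (fun T => ((T ⟨u, hu⟩ : U) : W)) hιA
    simp only [Module.End.mul_apply, hιU, hAZ] at h
    exact h
  have hZ2 : ∀ u ∈ U, Z (Θ u) = -(Z u) := fun u hu => by
    have h := congrArg (fun T => ((T ⟨u, hu⟩ : U) : W)) hAι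
    simp only [Module.End.mul_apply, LinearMap.neg_apply, Submodule.coe_neg, hAZ] at h
    rw [hιU] at h
    exact h
  obtain ⟨X, hX, hΘX, hXΘ, hXc, hXZ⟩ := UnitaryLeviLift.exists_raise_restrict hbr hΘ hΘΘ hιΘ hZ hZc hZ1 hZ2
  exact ⟨X, hX, hΘX, hXΘ, hXc, fun v => by rw [hXZ v v.2, hAZ v]⟩

/-- **A rank-one lift.** If the Levi algebra on `U⁺` is full and both pieces `P ∩ U⁺`, `Q ∩ U⁺` are non-zero, some
raising `X ∈ 𝔊` commuting with `ι` has `dim X(U⁺) = 1` (the raising component of a lift of `φ ⊗ e`,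
`UnitaryLeviFull.exists_raise_lift`). [cite: GoodmanWallachGTM255, §4.1.1] [cite: Deligne1982HodgeCycles, I §3 Prop. 3.4] -/
theorem UnitaryLeviSetup.exists_lift_rankOne [FiniteDimensional ℂ W] {𝔊 : Submodule ℂ (Module.End ℂ W)}
    (hbr : ∀ Y ∈ 𝔊, ∀ Z ∈ 𝔊, Y * Z - Z * Y ∈ 𝔊) {Θ : Module.End ℂ W} (hΘ : Θ ∈ 𝔊) (hΘΘ : Θ * Θ = 1)
    {ι : Module.End ℂ W} (hιΘ : ι * Θ = Θ * ι) {Up PU QU : Submodule ℂ W} (hUp : ∀ x, x ∈ Up ↔ ι x = x)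
    (hPU : ∀ x, x ∈ PU ↔ ι x = x ∧ Θ x = x) (hQU : ∀ x, x ∈ QU ↔ ι x = x ∧ Θ x = -x)
    (hPU0 : 0 < Module.finrank ℂ PU) (hQU0 : 0 < Module.finrank ℂ QU)
    (hfull : ∀ T : Module.End ℂ Up, ∃ Z ∈ 𝔊, Z * ι = ι * Z ∧ ∀ x : Up, ((T x : Up) : W) = Z x) :
    ∃ X ∈ 𝔊, Θ * X = X ∧ X * Θ = -X ∧ X * ι = ι * X ∧ Module.finrank ℂ (Up.map X) = 1 := by
  classical
  have hΘΘv : ∀ v, Θ (Θ v) = v := fun v => by rw [← Module.End.mul_apply, hΘΘ, Module.End.one_apply]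
  obtain ⟨⟨e, he⟩, he0⟩ := Module.finrank_pos_iff_exists_ne_zero.1 hPU0
  have he0' : e ≠ 0 := fun h => he0 (Subtype.ext h)
  obtain ⟨⟨q₁, hq₁⟩, hq₁0⟩ := Module.finrank_pos_iff_exists_ne_zero.1 hQU0
  have hq₁0' : q₁ ≠ 0 := fun h => hq₁0 (Subtype.ext h)
  obtain ⟨φ, hφ⟩ := Module.Projective.exists_dual_eq_one ℂ hq₁0'
  obtain ⟨X, hX, hΘX, hXΘ, hXc, hXv⟩ := UnitaryLeviFull.exists_raise_lift hbr hΘ hΘΘ hιΘ hUp hfull φ ((hPU e).1 he).2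
    ((hPU e).1 he).1
  have hkill : ∀ p, Θ p = p → X p = 0 := fun p hp => by
    have h : X p = -(X p) := by
      conv_lhs => rw [← hp, ← Module.End.mul_apply, hXΘ, LinearMap.neg_apply]
    have h2 : (2 : ℂ) • X p = 0 := by rw [two_smul]; nth_rewrite 2 [h]; rw [add_neg_cancel]
    exact (smul_eq_zero.1 h2).resolve_left two_ne_zero
  have hUpX : Up.map X = ℂ ∙ e := by
    apply le_antisymm
    · rintro _ ⟨v, hv, rfl⟩
      have hv' : v = (2 : ℂ)⁻¹ • (v + Θ v) + (2 : ℂ)⁻¹ • (v - Θ v) := by module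
      have hp : Θ ((2 : ℂ)⁻¹ • (v + Θ v)) = (2 : ℂ)⁻¹ • (v + Θ v) := by rw [map_smul, map_add, hΘΘv, add_comm]
      have hq : Θ ((2 : ℂ)⁻¹ • (v - Θ v)) = -((2 : ℂ)⁻¹ • (v - Θ v)) := by
        rw [map_smul, map_sub, hΘΘv, ← smul_neg, neg_sub]
      have hιq : ι ((2 : ℂ)⁻¹ • (v - Θ v)) = (2 : ℂ)⁻¹ • (v - Θ v) := by
        rw [map_smul, map_sub, ← Module.End.mul_apply, hιΘ, Module.End.mul_apply, (hUp v).1 hv]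
      rw [hv', map_add, hkill _ hp, zero_add, hXv _ hιq hq]
      exact Submodule.smul_mem _ _ (Submodule.mem_span_singleton_self e)
    · rw [Submodule.span_singleton_le_iff_mem]
      exact ⟨q₁, (hUp q₁).2 ((hQU q₁).1 hq₁).1, by rw [hXv q₁ ((hQU q₁).1 hq₁).1 ((hQU q₁).1 hq₁).2, hφ, one_smul]⟩
  exact ⟨X, hX, hΘX, hXΘ, hXc, by rw [hUpX, finrank_span_singleton he0']⟩

/-- **A lift of large `U⁺`-rank.** If the Levi algebra `L⁺` on `U⁺` is full, then for `k ≤ dim (P ∩ U⁺)`,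
`k ≤ dim (Q ∩ U⁺)` some raising `X ∈ 𝔊` commuting with `ι` has `dim X(U⁺) ≥ k`.
[cite: GoodmanWallachGTM255, §4.1.1] [cite: HoffmanKunze1971LinearAlgebra, §3.1 Thm. 2] -/
theorem UnitaryLeviSetup.exists_lift_le_finrank [FiniteDimensional ℂ W] {𝔊 : Submodule ℂ (Module.End ℂ W)}
    (hbr : ∀ Y ∈ 𝔊, ∀ Z ∈ 𝔊, Y * Z - Z * Y ∈ 𝔊) {Θ : Module.End ℂ W} (hΘ : Θ ∈ 𝔊) (hΘΘ : Θ * Θ = 1)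
    {ι : Module.End ℂ W} {Up : Submodule ℂ W} {Lp : Submodule ℂ (Module.End ℂ Up)} {ιp : Module.End ℂ Up}
    {Pp Qp : Submodule ℂ Up}
    (hcp : ∀ Z : Module.End ℂ W, Z * ι = ι * Z → ∀ x ∈ Up, Z x ∈ Up) (hιΘ : ι * Θ = Θ * ι)
    (hLp : ∀ A, A ∈ Lp ↔ ∃ Z ∈ 𝔊, Z * ι = ι * Z ∧ ∀ x : Up, ((A x : Up) : W) = Z x)
    (hιpapply : ∀ x : Up, ((ιp x : Up) : W) = Θ x) (hιpιp : ιp * ιp = 1)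
    (hPp : ∀ x, x ∈ Pp ↔ ιp x = x) (hQp : ∀ x, x ∈ Qp ↔ ιp x = -x) (hLptop : Lp = ⊤)
    {k : ℕ} (hkP : k ≤ Module.finrank ℂ Pp) (hkQ : k ≤ Module.finrank ℂ Qp) :
    ∃ X ∈ 𝔊, Θ * X = X ∧ X * Θ = -X ∧ X * ι = ι * X ∧ k ≤ Module.finrank ℂ (Up.map X) := by
  obtain ⟨T, hιT, hTι, hk⟩ := UnitaryRaisingSpace.exists_raise_le_finrank_range hιpιp hPp hQp hkP hkQ
  obtain ⟨X, hX, hΘX, hXΘ, hXc, hXT⟩ := UnitaryLeviSetup.exists_lift hbr hΘ hΘΘ hcp hιΘ hLp hιpapply T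
    (by rw [hLptop]; exact Submodule.mem_top) hιT hTι
  exact ⟨X, hX, hΘX, hXΘ, hXc, by rw [hXT]; exact hk⟩

/-! ### §2 The `(9 | 10)` cell: no raising operator of rank `2`, `4`, `5` -/

/-- (G1) At `(9, 10)`, if every raising operator has rank in `{0, 2, 4, 5, 6}`, none has rank `2`: at such a `B` the
Levi algebra `L⁺` (type `(7 | 2)`) is full (`UnitaryTwoOdd.eq_top'`); a rank-one element of it lifts to a raising `X`
commuting with `ι` of profile `(1, j)`, `1 + j ∈ {2}`, so `X|_{U⁻}` is a rank-one raising element of `L⁻` (type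
`(2 | 8)`), which is then full (`UnitaryRankOneRaise.eq_top_of_rankOne_raise_two`) — impossible on the larger side.
[cite: Ribet1983, Thm. 3] [cite: Gordon1997, Thm. 6.3 (3)] [cite: GoodmanWallachGTM255, §4.1.1] -/
theorem UnitaryNineTen.no_rank_two [FiniteDimensional ℂ W] {𝔊 : Submodule ℂ (Module.End ℂ W)}
    (hbr : ∀ Y ∈ 𝔊, ∀ Z ∈ 𝔊, Y * Z - Z * Y ∈ 𝔊)
    (hirr : ∀ U : Submodule ℂ W, (∀ A ∈ 𝔊, ∀ u ∈ U, A u ∈ U) → U = ⊥ ∨ U = ⊤)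
    {Θ : Module.End ℂ W} (hΘ : Θ ∈ 𝔊) (hΘΘ : Θ * Θ = 1)
    {P Q : Submodule ℂ W} (hP : ∀ x, x ∈ P ↔ Θ x = x) (hQ : ∀ x, x ∈ Q ↔ Θ x = -x)
    (hP9 : Module.finrank ℂ P = 9) (hQ10 : Module.finrank ℂ Q = 10)
    {s : W → W → ℂ} (hadd : ∀ x y z, s (x + y) z = s x z + s y z)
    (hsymm : ∀ x y, s y x = starRingEnd ℂ (s x y))
    (hPQ : ∀ p ∈ P, ∀ q ∈ Q, s p q = 0) (hdefP : ∀ p ∈ P, s p p = 0 → p = 0) (hdefQ : ∀ q ∈ Q, s q q = 0 → q = 0)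
    (hadj : ∀ X ∈ 𝔊, ∃ Y ∈ 𝔊, ∀ x y, s (X x) y = s x (Y y))
    (hS : ∀ B' ∈ 𝔊, Θ * B' = B' → B' * Θ = -B' →
      Module.finrank ℂ (LinearMap.range B') = 0 ∨ Module.finrank ℂ (LinearMap.range B') = 2 ∨
        Module.finrank ℂ (LinearMap.range B') = 4 ∨ Module.finrank ℂ (LinearMap.range B') = 5 ∨
        Module.finrank ℂ (LinearMap.range B') = 6)
    {B : Module.End ℂ W} (hB : B ∈ 𝔊) (hΘB : Θ * B = B) (hBΘ : B * Θ = -B)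
    (h2 : Module.finrank ℂ (LinearMap.range B) = 2) : False := by
  classical
  have hsU : ∀ U : Submodule ℂ W, ∀ x y z : U, s ((x + y : U) : W) z = s (x : W) z + s (y : W) z :=
    fun U x y z => by simp only [Submodule.coe_add, hadd]
  have hno1 : ∀ B' ∈ 𝔊, Θ * B' = B' → B' * Θ = -B' → Module.finrank ℂ (LinearMap.range B') ≠ 1 := by
    intro B' hB' hΘB' hB'Θ h1
    rcases hS B' hB' hΘB' hB'Θ with h | h | h | h | h <;> omega
  obtain ⟨ι, Um, Up, PU, QU, Lm, ιm, Pm, Qm, Lp, ιp, Pp, Qp, hιmem, hιι, hιΘ, hιs, hUm, hUp, hfinUm, hfinUp,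
    hPM, hQM, hPU, hQU, hrangeP, hPUP, hQUQ, hfinQM, hfinPU, hfinQU, hLm, hLp,
    hιmapply, hPmmem, hQmmem, hbrLm, hirrLm, hιmmem, hιmιm, hPm, hQm, hfinPm, hfinQm, hPmQm, hdefPm, hdefQm, hadjLm,
    hιpapply, hPpmem, hQpmem, hbrLp, hirrLp, hιpmem, hιpιp, hPp, hQp, hfinPp, hfinQp, hPpQp, hdefPp, hdefQp, hadjLp,
    hsplit⟩ :=
    UnitaryLeviSetup.exists_levi_pair hbr hirr hΘ hΘΘ hP hQ hadd hsymm hPQ hdefP hdefQ hadj hB hΘB hBΘ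
  rw [h2] at hfinQM hfinPU hfinQU hfinPm hfinQm hfinPp hfinQp hsplit
  rw [hQ10] at hfinQM hfinQm hfinUm
  rw [hP9] at hfinPU hfinPp hfinUp
  have hcm : ∀ Z : Module.End ℂ W, Z * ι = ι * Z → ∀ x ∈ Um, Z x ∈ Um := fun Z hZ x hx =>
    (hUm _).2 (by rw [← Module.End.mul_apply, ← hZ, Module.End.mul_apply, (hUm x).1 hx, map_neg])
  have hfullm_of : Lm = ⊤ → False := fun h =>
    UnitaryLeviSetup.false_of_full_larger hbr hΘΘ hno1 hιι hιΘ hUm hUp (by omega) (by omega) hPM hQM (by omega)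
      (by omega) hLm h
  -- `L⁺` (type `(7 | 2)`) is full: the `(odd | 2)` core
  have hLptop : Lp = ⊤ :=
    UnitaryTwoOdd.eq_top' hbrLp hirrLp hιpmem hιpιp hPp hQp ⟨3, by omega⟩ hfinQp
      (s := fun v w : Up => s (v : W) w) (hsU Up) (fun v w => hsymm v w) hPpQp hdefPp hdefQp hadjLp
  have hfullp : ∀ T : Module.End ℂ Up, ∃ Z ∈ 𝔊, Z * ι = ι * Z ∧ ∀ v : Up, ((T v : Up) : W) = Z v := fun T =>
    (hLp T).1 (by rw [hLptop]; exact Submodule.mem_top)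
  -- a rank-one lift has profile `(1, 1)`
  obtain ⟨X, hX, hΘX, hXΘ, hXc, hi1⟩ := UnitaryLeviSetup.exists_lift_rankOne hbr hΘ hΘΘ hιΘ hUp hPU hQU (by omega)
    (by omega) hfullp
  obtain ⟨hs, -, -, hj, -⟩ := hsplit X hΘX hXΘ hXc
  have hj1 : Module.finrank ℂ (Um.map X) = 1 := by
    have hr := hS X hX hΘX hXΘ
    rw [hs, hi1] at hr
    omega
  -- so `L⁻` (type `(2 | 8)`) is full — impossible on the larger side
  obtain ⟨hxmem, hιmx, hxιm, hxrk⟩ := UnitaryLeviSetup.restrict_mem hcm hLm hιmapply X hX hΘX hXΘ hXc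
  rw [hj1] at hxrk
  exact hfullm_of (UnitaryRankOneRaise.eq_top_of_rankOne_raise_two hbrLm hirrLm hιmmem hιmιm hPm hQm
    (s := fun v w : Um => s (v : W) w) (hsU Um) (fun v w => hsymm v w) hPmQm hdefPm hdefQm hadjLm hxmem hιmx hxιm
    hxrk hfinPm (by omega))

/-- (G2) At `(9, b)`, if every raising operator has rank in `{0, 4, 5, 6}`, none has rank `4`: at such a `B` the
Levi algebra `L⁺` (type `(5 | 4)`) is full (`UnitaryCoprimeStep.eq_top_five_four`); it provides raising `X₄`, `X₁`
commuting with `ι` with `rk X₄|_{U⁺} ≥ 4` and `rk X₁|_{U⁺} = 1`, hence `rk X₁|_{U⁻} ≥ 3` (`1 + j ∈ {4, 5, 6}`); a member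
of the pencil `X₁ + cX₄` then has rank `≥ 4 + 3 = 7 > 6` (two pencils). [cite: Ribet1983, Thm. 3]
[cite: Gordon1997, Thm. 6.3 (3)] [cite: GoodmanWallachGTM255, §4.1.1] [cite: HoffmanKunze1971LinearAlgebra, §3.1 Thm. 2] -/
theorem UnitaryNineTen.no_rank_four [FiniteDimensional ℂ W] {𝔊 : Submodule ℂ (Module.End ℂ W)}
    (hbr : ∀ Y ∈ 𝔊, ∀ Z ∈ 𝔊, Y * Z - Z * Y ∈ 𝔊)
    (hirr : ∀ U : Submodule ℂ W, (∀ A ∈ 𝔊, ∀ u ∈ U, A u ∈ U) → U = ⊥ ∨ U = ⊤)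
    {Θ : Module.End ℂ W} (hΘ : Θ ∈ 𝔊) (hΘΘ : Θ * Θ = 1)
    {P Q : Submodule ℂ W} (hP : ∀ x, x ∈ P ↔ Θ x = x) (hQ : ∀ x, x ∈ Q ↔ Θ x = -x)
    (hP9 : Module.finrank ℂ P = 9)
    {s : W → W → ℂ} (hadd : ∀ x y z, s (x + y) z = s x z + s y z)
    (hsymm : ∀ x y, s y x = starRingEnd ℂ (s x y))
    (hPQ : ∀ p ∈ P, ∀ q ∈ Q, s p q = 0) (hdefP : ∀ p ∈ P, s p p = 0 → p = 0) (hdefQ : ∀ q ∈ Q, s q q = 0 → q = 0)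
    (hadj : ∀ X ∈ 𝔊, ∃ Y ∈ 𝔊, ∀ x y, s (X x) y = s x (Y y))
    (hS : ∀ B' ∈ 𝔊, Θ * B' = B' → B' * Θ = -B' →
      Module.finrank ℂ (LinearMap.range B') = 0 ∨ Module.finrank ℂ (LinearMap.range B') = 4 ∨
        Module.finrank ℂ (LinearMap.range B') = 5 ∨ Module.finrank ℂ (LinearMap.range B') = 6)
    {B : Module.End ℂ W} (hB : B ∈ 𝔊) (hΘB : Θ * B = B) (hBΘ : B * Θ = -B)
    (hK : Module.finrank ℂ (LinearMap.range B) = 4) : False := by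
  classical
  have hsU : ∀ U : Submodule ℂ W, ∀ x y z : U, s ((x + y : U) : W) z = s (x : W) z + s (y : W) z :=
    fun U x y z => by simp only [Submodule.coe_add, hadd]
  obtain ⟨ι, Um, Up, PU, QU, Lm, ιm, Pm, Qm, Lp, ιp, Pp, Qp, hιmem, hιι, hιΘ, hιs, hUm, hUp, hfinUm, hfinUp,
    hPM, hQM, hPU, hQU, hrangeP, hPUP, hQUQ, hfinQM, hfinPU, hfinQU, hLm, hLp,
    hιmapply, hPmmem, hQmmem, hbrLm, hirrLm, hιmmem, hιmιm, hPm, hQm, hfinPm, hfinQm, hPmQm, hdefPm, hdefQm, hadjLm,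
    hιpapply, hPpmem, hQpmem, hbrLp, hirrLp, hιpmem, hιpιp, hPp, hQp, hfinPp, hfinQp, hPpQp, hdefPp, hdefQp, hadjLp,
    hsplit⟩ :=
    UnitaryLeviSetup.exists_levi_pair hbr hirr hΘ hΘΘ hP hQ hadd hsymm hPQ hdefP hdefQ hadj hB hΘB hBΘ
  rw [hK] at hfinQM hfinPU hfinQU hfinPm hfinQm hfinPp hfinQp hsplit
  rw [hP9] at hfinPU hfinPp hfinUp
  have hcm : ∀ Z : Module.End ℂ W, Z * ι = ι * Z → ∀ x ∈ Um, Z x ∈ Um := fun Z hZ x hx =>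
    (hUm _).2 (by rw [← Module.End.mul_apply, ← hZ, Module.End.mul_apply, (hUm x).1 hx, map_neg])
  have hcp : ∀ Z : Module.End ℂ W, Z * ι = ι * Z → ∀ x ∈ Up, Z x ∈ Up := fun Z hZ x hx =>
    (hUp _).2 (by rw [← Module.End.mul_apply, ← hZ, Module.End.mul_apply, (hUp x).1 hx])
  -- `L⁺` (type `(5 | 4)`) is full
  have hLptop : Lp = ⊤ :=
    UnitaryCoprimeStep.eq_top_five_four hbrLp hirrLp hιpmem hιpιp hPp hQp (by omega) hfinQp
      (s := fun v w : Up => s (v : W) w) (hsU Up) (fun v w => hsymm v w) hPpQp hdefPp hdefQp hadjLp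
  have hfullp : ∀ T : Module.End ℂ Up, ∃ Z ∈ 𝔊, Z * ι = ι * Z ∧ ∀ v : Up, ((T v : Up) : W) = Z v := fun T =>
    (hLp T).1 (by rw [hLptop]; exact Submodule.mem_top)
  -- `X₄` with `rk X₄|_{U⁺} ≥ 4`, `X₁` with `rk X₁|_{U⁺} = 1` and hence `rk X₁|_{U⁻} ≥ 3`
  obtain ⟨X₄, hX₄, hΘX₄, hX₄Θ, hX₄c, hi4⟩ := UnitaryLeviSetup.exists_lift_le_finrank hbr hΘ hΘΘ hcp hιΘ hLp hιpapply
    hιpιp hPp hQp hLptop (k := 4) (by omega) (by omega)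
  obtain ⟨X₁, hX₁, hΘX₁, hX₁Θ, hX₁c, hi1⟩ := UnitaryLeviSetup.exists_lift_rankOne hbr hΘ hΘΘ hιΘ hUp hPU hQU (by omega)
    (by omega) hfullp
  have hj3 : 3 ≤ Module.finrank ℂ (Um.map X₁) := by
    obtain ⟨hs, -, -, -, -⟩ := hsplit X₁ hΘX₁ hX₁Θ hX₁c
    have hr := hS X₁ hX₁ hΘX₁ hX₁Θ
    rw [hs, hi1] at hr
    omega
  -- two pencils
  obtain ⟨c, hc1, hc2⟩ := UnitaryGenericRank.exists_finrank_le_and_finrank_le (X₄.restrict (hcp X₄ hX₄c))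
    (X₁.restrict (hcp X₁ hX₁c)) (X₁.restrict (hcm X₁ hX₁c)) (X₄.restrict (hcm X₄ hX₄c))
  obtain ⟨hY, hΘY, hYΘ, hYc⟩ := UnitaryLeviSetup.add_smul_raise X₁ hX₁ hΘX₁ hX₁Θ hX₁c X₄ hX₄ hΘX₄ hX₄Θ hX₄c c
  have hiY := UnitaryLeviSetup.finrank_map_add_smul hcp X₁ X₄ hX₁c hX₄c c hYc
  have hjY := UnitaryLeviSetup.finrank_map_add_smul hcm X₁ X₄ hX₁c hX₄c c hYc
  have h4 : 4 ≤ Module.finrank ℂ (LinearMap.range (X₄.restrict (hcp X₄ hX₄c))) := by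
    rw [UnitaryLeviRank.finrank_range_restrict]; exact hi4
  have h3 : 3 ≤ Module.finrank ℂ (LinearMap.range (X₁.restrict (hcm X₁ hX₁c))) := by
    rw [UnitaryLeviRank.finrank_range_restrict]; exact hj3
  obtain ⟨hs, -, -, -, -⟩ := hsplit (X₁ + c • X₄) hΘY hYΘ hYc
  have hr := hS (X₁ + c • X₄) hY hΘY hYΘ
  rw [hs, hiY, hjY] at hr
  omega

/-- (G3) At `(9, b)`, if every raising operator has rank in `{0, 4, 5, 6}`, none has rank `5`: at such a `B` the
Levi algebra `L⁺` (type `(4 | 5)`) is full (`UnitaryCoprimeStep.eq_top_four_five`); it provides raising `X₄`, `X₁`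
commuting with `ι` with `rk X₄|_{U⁺} ≥ 4` and `rk X₁|_{U⁺} = 1`, hence `rk X₁|_{U⁻} ≥ 3` (`1 + j ∈ {4, 5, 6}`); a member
of the pencil `X₁ + cX₄` then has rank `≥ 4 + 3 = 7 > 6` (two pencils). [cite: Ribet1983, Thm. 3]
[cite: Gordon1997, Thm. 6.3 (3)] [cite: GoodmanWallachGTM255, §4.1.1] [cite: HoffmanKunze1971LinearAlgebra, §3.1 Thm. 2] -/
theorem UnitaryNineTen.no_rank_five [FiniteDimensional ℂ W] {𝔊 : Submodule ℂ (Module.End ℂ W)}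
    (hbr : ∀ Y ∈ 𝔊, ∀ Z ∈ 𝔊, Y * Z - Z * Y ∈ 𝔊)
    (hirr : ∀ U : Submodule ℂ W, (∀ A ∈ 𝔊, ∀ u ∈ U, A u ∈ U) → U = ⊥ ∨ U = ⊤)
    {Θ : Module.End ℂ W} (hΘ : Θ ∈ 𝔊) (hΘΘ : Θ * Θ = 1)
    {P Q : Submodule ℂ W} (hP : ∀ x, x ∈ P ↔ Θ x = x) (hQ : ∀ x, x ∈ Q ↔ Θ x = -x)
    (hP9 : Module.finrank ℂ P = 9)
    {s : W → W → ℂ} (hadd : ∀ x y z, s (x + y) z = s x z + s y z)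
    (hsymm : ∀ x y, s y x = starRingEnd ℂ (s x y))
    (hPQ : ∀ p ∈ P, ∀ q ∈ Q, s p q = 0) (hdefP : ∀ p ∈ P, s p p = 0 → p = 0) (hdefQ : ∀ q ∈ Q, s q q = 0 → q = 0)
    (hadj : ∀ X ∈ 𝔊, ∃ Y ∈ 𝔊, ∀ x y, s (X x) y = s x (Y y))
    (hS : ∀ B' ∈ 𝔊, Θ * B' = B' → B' * Θ = -B' →
      Module.finrank ℂ (LinearMap.range B') = 0 ∨ Module.finrank ℂ (LinearMap.range B') = 4 ∨
        Module.finrank ℂ (LinearMap.range B') = 5 ∨ Module.finrank ℂ (LinearMap.range B') = 6)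
    {B : Module.End ℂ W} (hB : B ∈ 𝔊) (hΘB : Θ * B = B) (hBΘ : B * Θ = -B)
    (hK : Module.finrank ℂ (LinearMap.range B) = 5) : False := by
  classical
  have hsU : ∀ U : Submodule ℂ W, ∀ x y z : U, s ((x + y : U) : W) z = s (x : W) z + s (y : W) z :=
    fun U x y z => by simp only [Submodule.coe_add, hadd]
  obtain ⟨ι, Um, Up, PU, QU, Lm, ιm, Pm, Qm, Lp, ιp, Pp, Qp, hιmem, hιι, hιΘ, hιs, hUm, hUp, hfinUm, hfinUp,
    hPM, hQM, hPU, hQU, hrangeP, hPUP, hQUQ, hfinQM, hfinPU, hfinQU, hLm, hLp,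
    hιmapply, hPmmem, hQmmem, hbrLm, hirrLm, hιmmem, hιmιm, hPm, hQm, hfinPm, hfinQm, hPmQm, hdefPm, hdefQm, hadjLm,
    hιpapply, hPpmem, hQpmem, hbrLp, hirrLp, hιpmem, hιpιp, hPp, hQp, hfinPp, hfinQp, hPpQp, hdefPp, hdefQp, hadjLp,
    hsplit⟩ :=
    UnitaryLeviSetup.exists_levi_pair hbr hirr hΘ hΘΘ hP hQ hadd hsymm hPQ hdefP hdefQ hadj hB hΘB hBΘ
  rw [hK] at hfinQM hfinPU hfinQU hfinPm hfinQm hfinPp hfinQp hsplit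
  rw [hP9] at hfinPU hfinPp hfinUp
  have hcm : ∀ Z : Module.End ℂ W, Z * ι = ι * Z → ∀ x ∈ Um, Z x ∈ Um := fun Z hZ x hx =>
    (hUm _).2 (by rw [← Module.End.mul_apply, ← hZ, Module.End.mul_apply, (hUm x).1 hx, map_neg])
  have hcp : ∀ Z : Module.End ℂ W, Z * ι = ι * Z → ∀ x ∈ Up, Z x ∈ Up := fun Z hZ x hx =>
    (hUp _).2 (by rw [← Module.End.mul_apply, ← hZ, Module.End.mul_apply, (hUp x).1 hx])
  -- `L⁺` (type `(4 | 5)`) is full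
  have hLptop : Lp = ⊤ :=
    UnitaryCoprimeStep.eq_top_four_five hbrLp hirrLp hιpmem hιpιp hPp hQp (by omega) hfinQp
      (s := fun v w : Up => s (v : W) w) (hsU Up) (fun v w => hsymm v w) hPpQp hdefPp hdefQp hadjLp
  have hfullp : ∀ T : Module.End ℂ Up, ∃ Z ∈ 𝔊, Z * ι = ι * Z ∧ ∀ v : Up, ((T v : Up) : W) = Z v := fun T =>
    (hLp T).1 (by rw [hLptop]; exact Submodule.mem_top)
  -- `X₄` with `rk X₄|_{U⁺} ≥ 4`, `X₁` with `rk X₁|_{U⁺} = 1` and hence `rk X₁|_{U⁻} ≥ 3`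
  obtain ⟨X₄, hX₄, hΘX₄, hX₄Θ, hX₄c, hi4⟩ := UnitaryLeviSetup.exists_lift_le_finrank hbr hΘ hΘΘ hcp hιΘ hLp hιpapply
    hιpιp hPp hQp hLptop (k := 4) (by omega) (by omega)
  obtain ⟨X₁, hX₁, hΘX₁, hX₁Θ, hX₁c, hi1⟩ := UnitaryLeviSetup.exists_lift_rankOne hbr hΘ hΘΘ hιΘ hUp hPU hQU (by omega)
    (by omega) hfullp
  have hj3 : 3 ≤ Module.finrank ℂ (Um.map X₁) := by
    obtain ⟨hs, -, -, -, -⟩ := hsplit X₁ hΘX₁ hX₁Θ hX₁c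
    have hr := hS X₁ hX₁ hΘX₁ hX₁Θ
    rw [hs, hi1] at hr
    omega
  -- two pencils
  obtain ⟨c, hc1, hc2⟩ := UnitaryGenericRank.exists_finrank_le_and_finrank_le (X₄.restrict (hcp X₄ hX₄c))
    (X₁.restrict (hcp X₁ hX₁c)) (X₁.restrict (hcm X₁ hX₁c)) (X₄.restrict (hcm X₄ hX₄c))
  obtain ⟨hY, hΘY, hYΘ, hYc⟩ := UnitaryLeviSetup.add_smul_raise X₁ hX₁ hΘX₁ hX₁Θ hX₁c X₄ hX₄ hΘX₄ hX₄Θ hX₄c c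
  have hiY := UnitaryLeviSetup.finrank_map_add_smul hcp X₁ X₄ hX₁c hX₄c c hYc
  have hjY := UnitaryLeviSetup.finrank_map_add_smul hcm X₁ X₄ hX₁c hX₄c c hYc
  have h4 : 4 ≤ Module.finrank ℂ (LinearMap.range (X₄.restrict (hcp X₄ hX₄c))) := by
    rw [UnitaryLeviRank.finrank_range_restrict]; exact hi4
  have h3 : 3 ≤ Module.finrank ℂ (LinearMap.range (X₁.restrict (hcm X₁ hX₁c))) := by
    rw [UnitaryLeviRank.finrank_range_restrict]; exact hj3
  obtain ⟨hs, -, -, -, -⟩ := hsplit (X₁ + c • X₄) hΘY hYΘ hYc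
  have hr := hS (X₁ + c • X₄) hY hΘY hYΘ
  rw [hs, hiY, hjY] at hr
  omega

/-! ### §3 The residual case: constant raising rank `6` on type `(9 | 10)` -/

/-- (G4) **An irreducible unitary algebra of type `(9 | 10)` cannot have all its non-zero raising operators of rank
`6`** (lit-g86's problem (**)). At a rank-`6` raising `B` (maximal) the Levi algebras have types `(3 | 6)` and
`(6 | 4)`; the profiles `(i, j)` of raising operators commuting with `ι` are `(0,0)`, `(2,4)`, `(3,3)` (`i = 1` is
killed by the maximality polarisation, `j ≤ 4`, `i + j ∈ {0, 6}`); `(2,4)` and `(3,3)` do not coexist (two pencils give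
rank `7`); `(2,4)` alone makes `L⁺` a `(3 | 6)` algebra of constant raising rank `2` (TOOL B
`UnitaryThree.exists_raise_rank_ne_two`); `(3,3)` alone makes BOTH Levi algebras of constant raising rank `3`, and then
`L⁺` has at most two independent raising operators (`UnitaryConstantRank.exists_pair_span_raise`) while `L⁻` has three
(`UnitaryConstantRank.exists_three_raise_linearIndependent`) — but lifting the three to `𝔊` and restricting to `U⁺`
gives a dependence relation whose combination has profile `(0, ·)`, hence `(0, 0)`, hence restricts to zero on `U⁻`.
[cite: Ribet1983, Thm. 3] [cite: Gordon1997, Thm. 6.3 (3)] [cite: Deligne1982HodgeCycles, I §3 Prop. 3.4, 3.6]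
[cite: GoodmanWallachGTM255, §4.1.1] [cite: HoffmanKunze1971LinearAlgebra, §3.1 Thm. 2] -/
theorem UnitaryNineTen.false_of_rank_zero_or_six [FiniteDimensional ℂ W] {𝔊 : Submodule ℂ (Module.End ℂ W)}
    (hbr : ∀ Y ∈ 𝔊, ∀ Z ∈ 𝔊, Y * Z - Z * Y ∈ 𝔊)
    (hirr : ∀ U : Submodule ℂ W, (∀ A ∈ 𝔊, ∀ u ∈ U, A u ∈ U) → U = ⊥ ∨ U = ⊤)
    {Θ : Module.End ℂ W} (hΘ : Θ ∈ 𝔊) (hΘΘ : Θ * Θ = 1)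
    {P Q : Submodule ℂ W} (hP : ∀ x, x ∈ P ↔ Θ x = x) (hQ : ∀ x, x ∈ Q ↔ Θ x = -x)
    (hP9 : Module.finrank ℂ P = 9) (hQ10 : Module.finrank ℂ Q = 10)
    {s : W → W → ℂ} (hadd : ∀ x y z, s (x + y) z = s x z + s y z)
    (hsymm : ∀ x y, s y x = starRingEnd ℂ (s x y))
    (hPQ : ∀ p ∈ P, ∀ q ∈ Q, s p q = 0) (hdefP : ∀ p ∈ P, s p p = 0 → p = 0) (hdefQ : ∀ q ∈ Q, s q q = 0 → q = 0)
    (hadj : ∀ X ∈ 𝔊, ∃ Y ∈ 𝔊, ∀ x y, s (X x) y = s x (Y y))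
    (hS : ∀ B' ∈ 𝔊, Θ * B' = B' → B' * Θ = -B' →
      Module.finrank ℂ (LinearMap.range B') = 0 ∨ Module.finrank ℂ (LinearMap.range B') = 6) : False := by
  classical
  have hsU : ∀ U : Submodule ℂ W, ∀ x y z : U, s ((x + y : U) : W) z = s (x : W) z + s (y : W) z :=
    fun U x y z => by simp only [Submodule.coe_add, hadd]
  have hno1 : ∀ B' ∈ 𝔊, Θ * B' = B' → B' * Θ = -B' → Module.finrank ℂ (LinearMap.range B') ≠ 1 := by
    intro B' hB' hΘB' hB'Θ h1
    rcases hS B' hB' hΘB' hB'Θ with h | h <;> omega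
  obtain ⟨B, hB, hΘB, hBΘ, hr2⟩ :=
    UnitaryThreeCoprime.exists_raise_rank_ge_two hbr hirr hΘ hΘΘ hP hQ (by omega) (by omega)
  have h6 : Module.finrank ℂ (LinearMap.range B) = 6 := by
    rcases hS B hB hΘB hBΘ with h | h <;> omega
  have hmax : ∀ B' ∈ 𝔊, Θ * B' = B' → B' * Θ = -B' →
      Module.finrank ℂ (LinearMap.range B') ≤ Module.finrank ℂ (LinearMap.range B) := by
    intro B' hB' hΘB' hB'Θ
    rcases hS B' hB' hΘB' hB'Θ with h | h <;> omega
  obtain ⟨ι, Um, Up, PU, QU, Lm, ιm, Pm, Qm, Lp, ιp, Pp, Qp, hιmem, hιι, hιΘ, hιs, hUm, hUp, hfinUm, hfinUp,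
    hPM, hQM, hPU, hQU, hrangeP, hPUP, hQUQ, hfinQM, hfinPU, hfinQU, hLm, hLp,
    hιmapply, hPmmem, hQmmem, hbrLm, hirrLm, hιmmem, hιmιm, hPm, hQm, hfinPm, hfinQm, hPmQm, hdefPm, hdefQm, hadjLm,
    hιpapply, hPpmem, hQpmem, hbrLp, hirrLp, hιpmem, hιpιp, hPp, hQp, hfinPp, hfinQp, hPpQp, hdefPp, hdefQp, hadjLp,
    hsplit⟩ :=
    UnitaryLeviSetup.exists_levi_pair hbr hirr hΘ hΘΘ hP hQ hadd hsymm hPQ hdefP hdefQ hadj hB hΘB hBΘ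
  rw [h6] at hfinQM hfinPU hfinQU hfinPm hfinQm hfinPp hfinQp hsplit
  rw [hQ10] at hfinQM hfinQm hfinUm
  rw [hP9] at hfinPU hfinPp hfinUp
  have hcm : ∀ Z : Module.End ℂ W, Z * ι = ι * Z → ∀ x ∈ Um, Z x ∈ Um := fun Z hZ x hx =>
    (hUm _).2 (by rw [← Module.End.mul_apply, ← hZ, Module.End.mul_apply, (hUm x).1 hx, map_neg])
  have hcp : ∀ Z : Module.End ℂ W, Z * ι = ι * Z → ∀ x ∈ Up, Z x ∈ Up := fun Z hZ x hx =>
    (hUp _).2 (by rw [← Module.End.mul_apply, ← hZ, Module.End.mul_apply, (hUp x).1 hx])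
  -- a full `L⁺` is impossible (`B` has maximal rank: maximality polarisation)
  have hfullp_of : Lp = ⊤ → False := by
    intro hLptop
    have hfullp : ∀ T : Module.End ℂ Up, ∃ Z ∈ 𝔊, Z * ι = ι * Z ∧ ∀ v : Up, ((T v : Up) : W) = Z v := fun T =>
      (hLp T).1 (by rw [hLptop]; exact Submodule.mem_top)
    obtain ⟨e₁, he₁, e₂, he₂, he₁0, he₂1⟩ := UnitaryPencil.exists_pair_of_two_le_finrank PU (by omega)
    have hind : ∀ a b : ℂ, a • e₁ + b • e₂ = 0 → a = 0 ∧ b = 0 := by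
      intro a b hab
      by_cases hb : b = 0
      · rw [hb, zero_smul, add_zero] at hab
        exact ⟨(smul_eq_zero.1 hab).resolve_right he₁0, hb⟩
      · exfalso
        apply he₂1
        rw [Submodule.mem_span_singleton]
        refine ⟨-(b⁻¹ * a), ?_⟩
        have : e₂ = b⁻¹ • (b • e₂) := by rw [smul_smul, inv_mul_cancel₀ hb, one_smul]
        rw [this, eq_neg_of_add_eq_zero_right hab]
        module
    obtain ⟨⟨c₁, hc₁⟩, hc₁0⟩ := Module.finrank_pos_iff_exists_ne_zero.1 (show 0 < Module.finrank ℂ QU by omega)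
    obtain ⟨B₁, hB₁, hΘB₁, hB₁Θ, hr1⟩ := UnitaryLeviFull.exists_rankOne_raise_of_maxRank hbr hΘ hΘΘ hB hΘB hBΘ hmax hιι
      hιΘ (fun w => ((hPM _).1 (LinearMap.mem_range_self B w)).1)
      (fun v hιv hΘv => LinearMap.mem_ker.1 (Submodule.mem_inf.1 ((hQM v).2 ⟨hιv, hΘv⟩)).2)
      (fun v hΘv hBv => ((hQM v).1 (Submodule.mem_inf.2 ⟨(hQ v).2 hΘv, LinearMap.mem_ker.2 hBv⟩)).1) hUp hfullp
      ((hPU e₁).1 he₁).2 ((hPU e₁).1 he₁).1 ((hPU e₂).1 he₂).2 ((hPU e₂).1 he₂).1 hind ((hQU c₁).1 hc₁).2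
      ((hQU c₁).1 hc₁).1 (fun h => hc₁0 (Subtype.ext h))
    exact hno1 B₁ hB₁ hΘB₁ hB₁Θ hr1
  -- kill `i = 1` (`L⁺` of type `(3 | 6)`)
  have hkillp1 : ∀ X ∈ 𝔊, Θ * X = X → X * Θ = -X → X * ι = ι * X → Module.finrank ℂ (Up.map X) ≠ 1 := by
    intro X hX hΘX hXΘ hXc h1
    obtain ⟨hymem, hιpy, hyιp, hyrk⟩ := UnitaryLeviSetup.restrict_mem hcp hLp hιpapply X hX hΘX hXΘ hXc
    rw [h1] at hyrk
    exact hfullp_of (UnitaryRankOneRaise.eq_top_of_rankOne_raise hbrLp hirrLp hιpmem hιpιp hPp hQp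
      (s := fun v w : Up => s (v : W) w) (hsU Up) (fun v w => hsymm v w) hPpQp hdefPp hdefQp hadjLp hymem hιpy hyιp
      hyrk (by omega) (by omega) (by omega))
  -- the profiles are `(0, 0)`, `(2, 4)`, `(3, 3)`
  have hprof : ∀ X ∈ 𝔊, Θ * X = X → X * Θ = -X → X * ι = ι * X →
      (Module.finrank ℂ (Up.map X) = 0 ∧ Module.finrank ℂ (Um.map X) = 0) ∨
        (Module.finrank ℂ (Up.map X) = 2 ∧ Module.finrank ℂ (Um.map X) = 4) ∨
        (Module.finrank ℂ (Up.map X) = 3 ∧ Module.finrank ℂ (Um.map X) = 3) := by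
    intro X hX hΘX hXΘ hXc
    obtain ⟨hs, hi, hi', hj, hj'⟩ := hsplit X hΘX hXΘ hXc
    have h1 := hkillp1 X hX hΘX hXΘ hXc
    have hr := hS X hX hΘX hXΘ
    rw [hs] at hr
    omega
  -- `(2, 4)` and `(3, 3)` do not coexist (two pencils)
  have hnotboth : ∀ X ∈ 𝔊, Θ * X = X → X * Θ = -X → X * ι = ι * X → ∀ X' ∈ 𝔊, Θ * X' = X' → X' * Θ = -X' →
      X' * ι = ι * X' → Module.finrank ℂ (Up.map X) = 2 → Module.finrank ℂ (Up.map X') = 3 → False := by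
    intro X hX hΘX hXΘ hXc X' hX' hΘX' hX'Θ hX'c h2 h3
    have hj4 : Module.finrank ℂ (Um.map X) = 4 := by
      rcases hprof X hX hΘX hXΘ hXc with h | h | h <;> omega
    obtain ⟨c, hc1, hc2⟩ := UnitaryGenericRank.exists_finrank_le_and_finrank_le (X'.restrict (hcp X' hX'c))
      (X.restrict (hcp X hXc)) (X.restrict (hcm X hXc)) (X'.restrict (hcm X' hX'c))
    obtain ⟨hX₁, hΘX₁, hX₁Θ, hX₁c⟩ := UnitaryLeviSetup.add_smul_raise X hX hΘX hXΘ hXc X' hX' hΘX' hX'Θ hX'c c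
    have hi₁ := UnitaryLeviSetup.finrank_map_add_smul hcp X X' hXc hX'c c hX₁c
    have hj₁ := UnitaryLeviSetup.finrank_map_add_smul hcm X X' hXc hX'c c hX₁c
    have hy' : Module.finrank ℂ (LinearMap.range (X'.restrict (hcp X' hX'c))) = 3 := by
      rw [UnitaryLeviRank.finrank_range_restrict, h3]
    have hx : Module.finrank ℂ (LinearMap.range (X.restrict (hcm X hXc))) = 4 := by
      rw [UnitaryLeviRank.finrank_range_restrict, hj4]
    have hp := hprof (X + c • X') hX₁ hΘX₁ hX₁Θ hX₁c
    rw [hi₁, hj₁] at hp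
    omega
  -- some `X₀` moves `U⁺`
  obtain ⟨⟨p, hp⟩, hp0⟩ := Module.finrank_pos_iff_exists_ne_zero.1 (show 0 < Module.finrank ℂ PU by omega)
  obtain ⟨⟨q, hq⟩, hq0⟩ := Module.finrank_pos_iff_exists_ne_zero.1 (show 0 < Module.finrank ℂ QU by omega)
  obtain ⟨X₀, hX₀, hΘX₀, hX₀Θ, hX₀c, c, hιc, hΘc, hX₀c0⟩ :=
    UnitaryLeviFull.exists_raise_commute_apply_ne_zero hbr hirr hΘ hΘΘ hQ hιmem hιι hιΘ hUm hUp
      ⟨p, fun h => hp0 (Subtype.ext h), ((hPU p).1 hp).1, ((hPU p).1 hp).2⟩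
      ⟨q, fun h => hq0 (Subtype.ext h), ((hQU q).1 hq).1, ((hQU q).1 hq).2⟩
  have hX₀i : Module.finrank ℂ (Up.map X₀) ≠ 0 := fun h0 => by
    have hmem : X₀ c ∈ Up.map X₀ := Submodule.mem_map_of_mem ((hUp c).2 hιc)
    rw [Submodule.finrank_eq_zero.1 h0, Submodule.mem_bot] at hmem
    exact hX₀c0 hmem
  rcases hprof X₀ hX₀ hΘX₀ hX₀Θ hX₀c with ⟨hi0, -⟩ | ⟨hi2, -⟩ | ⟨hi3, -⟩
  · exact hX₀i hi0
  · -- every profile is `(0,0)` or `(2,4)`: `L⁺` (type `(3 | 6)`) has constant raising rank `2` — TOOL B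
    obtain ⟨A, hA, hιpA, hAιp, hAne, hA2⟩ :=
      UnitaryThree.exists_raise_rank_ne_two hbrLp hirrLp hιpmem hιpιp hPp hQp (by omega) (by omega)
        (s := fun v w : Up => s (v : W) w) (hsU Up) (fun v w => hsymm v w) hPpQp hdefPp hdefQp hadjLp
    obtain ⟨X, hX, hΘX, hXΘ, hXc, hXUp⟩ := UnitaryLeviSetup.exists_lift hbr hΘ hΘΘ hcp hιΘ hLp hιpapply A hA hιpA hAιp
    have hA0 : Module.finrank ℂ (LinearMap.range A) ≠ 0 := fun h =>
      hAne (LinearMap.range_eq_bot.1 (Submodule.finrank_eq_zero.1 h))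
    rcases hprof X hX hΘX hXΘ hXc with ⟨h, -⟩ | ⟨h, -⟩ | ⟨h, -⟩
    · exact hA0 (hXUp ▸ h)
    · exact hA2 (hXUp ▸ h)
    · exact hnotboth X₀ hX₀ hΘX₀ hX₀Θ hX₀c X hX hΘX hXΘ hXc hi2 h
  · -- every profile is `(0,0)` or `(3,3)`: BOTH Levi algebras have constant raising rank `3`
    have hSp : ∀ A ∈ Lp, ιp * A = A → A * ιp = -A → A ≠ 0 → Module.finrank ℂ (LinearMap.range A) = 3 := by
      intro A hA hιpA hAιp hAne
      obtain ⟨X, hX, hΘX, hXΘ, hXc, hXUp⟩ :=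
        UnitaryLeviSetup.exists_lift hbr hΘ hΘΘ hcp hιΘ hLp hιpapply A hA hιpA hAιp
      have hA0 : Module.finrank ℂ (LinearMap.range A) ≠ 0 := fun h =>
        hAne (LinearMap.range_eq_bot.1 (Submodule.finrank_eq_zero.1 h))
      rcases hprof X hX hΘX hXΘ hXc with ⟨h, -⟩ | ⟨h, -⟩ | ⟨h, -⟩
      · exact (hA0 (hXUp ▸ h)).elim
      · exact (hnotboth X hX hΘX hXΘ hXc X₀ hX₀ hΘX₀ hX₀Θ hX₀c h hi3).elim
      · rw [← hXUp, h]
    have hSm : ∀ A ∈ Lm, ιm * A = A → A * ιm = -A →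
        Module.finrank ℂ (LinearMap.range A) = 0 ∨ Module.finrank ℂ (LinearMap.range A) = 3 := by
      intro A hA hιmA hAιm
      obtain ⟨X, hX, hΘX, hXΘ, hXc, hXUm⟩ :=
        UnitaryLeviSetup.exists_lift hbr hΘ hΘΘ hcm hιΘ hLm hιmapply A hA hιmA hAιm
      rcases hprof X hX hΘX hXΘ hXc with ⟨-, h⟩ | ⟨h', -⟩ | ⟨-, h⟩
      · exact Or.inl (hXUm ▸ h)
      · exact (hnotboth X hX hΘX hXΘ hXc X₀ hX₀ hΘX₀ hX₀Θ hX₀c h' hi3).elim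
      · exact Or.inr (hXUm ▸ h)
    -- `L⁺`: at most two independent raising operators; `L⁻`: three
    obtain ⟨Y₁, Y₂, hspan⟩ := UnitaryConstantRank.exists_pair_span_raise hbrLp hιpmem hιpιp hPp hQp (r := 3)
      (by norm_num) (by omega) (by omega) (s := fun v w : Up => s (v : W) w) (hsU Up) (fun v w => hsymm v w) hPpQp
      hdefPp hdefQp hadjLp hSp
    obtain ⟨A, hA, hLI⟩ := UnitaryConstantRank.exists_three_raise_linearIndependent hbrLm hirrLm hιmmem hιmιm hPm hQm
      (r := 3) (by norm_num) (by omega) (by omega) (by omega) hSm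
    -- lift the three, restrict to `U⁺`
    have hlift : ∀ k, ∃ X ∈ 𝔊, Θ * X = X ∧ X * Θ = -X ∧ X * ι = ι * X ∧ ∀ v : Um, X v = ((A k v : Um) : W) :=
      fun k => UnitaryLeviSetup.exists_lift_eq hbr hΘ hΘΘ hιΘ hLm hιmapply (A k) (hA k).1 (hA k).2.1 (hA k).2.2
    choose X hX hΘX hXΘ hXc hXv using hlift
    set A' : Fin 3 → Module.End ℂ Up := fun k => (X k).restrict (hcp (X k) (hXc k)) with hA'def
    have hA'mem : ∀ k, A' k ∈ Lp ∧ ιp * A' k = A' k ∧ A' k * ιp = -(A' k) := fun k => by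
      obtain ⟨hm, h1, h2, -⟩ := UnitaryLeviSetup.restrict_mem hcp hLp hιpapply (X k) (hX k) (hΘX k) (hXΘ k) (hXc k)
      exact ⟨hm, h1, h2⟩
    have hdep : ¬ LinearIndependent ℂ A' := by
      intro hLI'
      have h3 : Module.finrank ℂ (Submodule.span ℂ (Set.range A')) = 3 := by
        rw [finrank_span_eq_card hLI', Fintype.card_fin]
      have hle : Submodule.span ℂ (Set.range A') ≤ Submodule.span ℂ ({Y₁, Y₂} : Set (Module.End ℂ Up)) := by
        refine Submodule.span_le.2 ?_
        rintro _ ⟨k, rfl⟩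
        exact hspan (A' k) (hA'mem k).1 (hA'mem k).2.1 (hA'mem k).2.2
      have h2 : Module.finrank ℂ (Submodule.span ℂ ({Y₁, Y₂} : Set (Module.End ℂ Up))) ≤ 2 := by
        have h := finrank_span_finset_le_card (R := ℂ) ({Y₁, Y₂} : Finset (Module.End ℂ Up))
        rw [Set.finrank, Finset.coe_insert, Finset.coe_singleton] at h
        exact h.trans Finset.card_le_two
      have := Submodule.finrank_mono hle
      omega
    obtain ⟨g, hg, k₀, hk₀⟩ := Fintype.not_linearIndependent_iff.1 hdep
    -- the combination `Σ gₖ Xₖ` vanishes on `U⁺`, hence on `U⁻`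
    obtain ⟨Xg, hXgdef⟩ : ∃ Xg : Module.End ℂ W, Xg = g 0 • X 0 + g 1 • X 1 + g 2 • X 2 := ⟨_, rfl⟩
    have hXgmem : Xg ∈ 𝔊 := by
      rw [hXgdef]
      exact Submodule.add_mem _ (Submodule.add_mem _ (Submodule.smul_mem _ _ (hX 0)) (Submodule.smul_mem _ _ (hX 1)))
        (Submodule.smul_mem _ _ (hX 2))
    have hΘXg : Θ * Xg = Xg := by rw [hXgdef, mul_add, mul_add, mul_smul_comm, mul_smul_comm, mul_smul_comm, hΘX, hΘX, hΘX]
    have hXgΘ : Xg * Θ = -Xg := by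
      rw [hXgdef, add_mul, add_mul, smul_mul_assoc, smul_mul_assoc, smul_mul_assoc, hXΘ, hXΘ, hXΘ, smul_neg, smul_neg,
        smul_neg, neg_add, neg_add]
    have hXgc : Xg * ι = ι * Xg := by
      rw [hXgdef, add_mul, add_mul, mul_add, mul_add, smul_mul_assoc, smul_mul_assoc, smul_mul_assoc, mul_smul_comm,
        mul_smul_comm, mul_smul_comm, hXc, hXc, hXc]
    have hXgapply : ∀ w, Xg w = g 0 • X 0 w + g 1 • X 1 w + g 2 • X 2 w := fun w => by
      rw [hXgdef]; simp only [LinearMap.add_apply, LinearMap.smul_apply]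
    have hXgUp : ∀ v ∈ Up, Xg v = 0 := fun v hv => by
      have h := congrArg (fun T : Module.End ℂ Up => ((T ⟨v, hv⟩ : Up) : W)) hg
      simp only [Fin.sum_univ_three, LinearMap.add_apply, LinearMap.smul_apply, LinearMap.zero_apply,
        Submodule.coe_add, Submodule.coe_smul, Submodule.coe_zero, hA'def, LinearMap.coe_restrict_apply] at h
      rw [hXgapply]; exact h
    have hi0 : Module.finrank ℂ (Up.map Xg) = 0 := by
      rw [Submodule.finrank_eq_zero, Submodule.eq_bot_iff]
      rintro _ ⟨v, hv, rfl⟩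
      exact hXgUp v hv
    have hj0 : Module.finrank ℂ (Um.map Xg) = 0 := by
      rcases hprof Xg hXgmem hΘXg hXgΘ hXgc with ⟨-, h⟩ | ⟨h, -⟩ | ⟨h, -⟩ <;> omega
    have hXgUm : ∀ v ∈ Um, Xg v = 0 := fun v hv => by
      have hmem : Xg v ∈ Um.map Xg := Submodule.mem_map_of_mem hv
      rwa [Submodule.finrank_eq_zero.1 hj0, Submodule.mem_bot] at hmem
    have hsum : ∑ k, g k • A k = 0 := by
      refine LinearMap.ext fun v => Subtype.ext ?_
      simp only [Fin.sum_univ_three, LinearMap.add_apply, LinearMap.smul_apply, LinearMap.zero_apply, Submodule.coe_add,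
        Submodule.coe_smul, Submodule.coe_zero, ← hXv]
      rw [← hXgapply]
      exact hXgUm v v.2
    exact hk₀ (Fintype.linearIndependent_iff.1 hLI g hsum k₀)

/-! ### §4 The `(9 | 10)` core and its mirror -/

/-- **THE `Θ`-SUBALGEBRA THEOREM FOR UNITARY MULTIPLICITIES `(9, 10)` — complex Hermitian core, classification-free.**
`𝔊 ⊆ End(W)` bracket-closed and irreducible, `Θ ∈ 𝔊` an involution with `dim P = 9`, `dim Q = 10`, Hermitian data
(`s` additive and `ℂ`-homogeneous in the first slot, Hermitian-symmetric, `P ⊥ Q`, definite on `P` and on `Q`), `𝔊`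
adjoint-closed ⟹ `𝔊 = End(W)`. Good ranks `1, 3, 7, 9` (larger-side Levi types `(1|9)`, `(3|7)`, `(7|3)`, `(9|1)` are
tree cores), `8 → 9` (triple route), then §2 (no `2`, `4`, `5`) and §3 (constant rank `6`). See the module docstring.
[cite: Ribet1983, Thm. 3] [cite: Gordon1997, Thm. 6.3 (3)] [cite: Deligne1982HodgeCycles, I §3 Prop. 3.4, 3.6]
[cite: GoodmanWallachGTM255, §4.1.1] -/
theorem UnitaryNineTen.eq_top_of_smul [FiniteDimensional ℂ W] {𝔊 : Submodule ℂ (Module.End ℂ W)}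
    (hbr : ∀ Y ∈ 𝔊, ∀ Z ∈ 𝔊, Y * Z - Z * Y ∈ 𝔊)
    (hirr : ∀ U : Submodule ℂ W, (∀ A ∈ 𝔊, ∀ u ∈ U, A u ∈ U) → U = ⊥ ∨ U = ⊤)
    {Θ : Module.End ℂ W} (hΘ : Θ ∈ 𝔊) (hΘΘ : Θ * Θ = 1)
    {P Q : Submodule ℂ W} (hP : ∀ x, x ∈ P ↔ Θ x = x) (hQ : ∀ x, x ∈ Q ↔ Θ x = -x)
    (hP9 : Module.finrank ℂ P = 9) (hQ10 : Module.finrank ℂ Q = 10)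
    {s : W → W → ℂ} (hadd : ∀ x y z, s (x + y) z = s x z + s y z)
    (hsmul : ∀ (c : ℂ) (x y : W), s (c • x) y = c * s x y) (hsymm : ∀ x y, s y x = starRingEnd ℂ (s x y))
    (hPQ : ∀ p ∈ P, ∀ q ∈ Q, s p q = 0) (hdefP : ∀ p ∈ P, s p p = 0 → p = 0) (hdefQ : ∀ q ∈ Q, s q q = 0 → q = 0)
    (hadj : ∀ X ∈ 𝔊, ∃ Y ∈ 𝔊, ∀ x y, s (X x) y = s x (Y y)) : 𝔊 = ⊤ := by
  classical
  have hraiseval : ∀ Z : Module.End ℂ W, Θ * Z = Z → ∀ w, Z w ∈ P := fun Z hΘZ w =>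
    (hP _).2 (by rw [← Module.End.mul_apply, hΘZ])
  have hle9 : ∀ B' : Module.End ℂ W, Θ * B' = B' → Module.finrank ℂ (LinearMap.range B') ≤ 9 := fun B' h => by
    rw [← hP9]
    exact Submodule.finrank_mono (by rintro _ ⟨w, rfl⟩; exact hraiseval B' h w)
  have hsU : ∀ U : Submodule ℂ W, ∀ x y z : U, s ((x + y : U) : W) z = s (x : W) z + s (y : W) z :=
    fun U x y z => by simp only [Submodule.coe_add, hadd]
  -- STEP 1: the good ranks `1, 3, 7, 9`
  have key : ∀ B' ∈ 𝔊, Θ * B' = B' → B' * Θ = -B' →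
      (Module.finrank ℂ (LinearMap.range B') = 1 ∨ Module.finrank ℂ (LinearMap.range B') = 3 ∨
        Module.finrank ℂ (LinearMap.range B') = 7 ∨ Module.finrank ℂ (LinearMap.range B') = 9) → 𝔊 = ⊤ := by
    intro B' hB' hΘB' hB'Θ hr
    refine UnitaryDoubleLevi.eq_top_of_raise_of_core hbr hirr hΘ hΘΘ hP hQ hadd hsymm hPQ hdefP hdefQ hadj hB' hΘB' hB'Θ
      (by omega) (by omega) (by omega)
      fun U 𝔩 ι P' Q' hbr𝔩 hirr𝔩 hι hιι hP' hQ' hfinP' hfinQ' hP'Q' hdefP' hdefQ' hadj𝔩 => ?_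
    rw [hQ10] at hfinQ'
    rcases hr with h | h | h | h <;> rw [h] at hfinP' hfinQ'
    · -- `(1 | 9)`: the `(m, 1)` core for `−ι`
      exact UnitaryThreeCoprime.eq_top_of_finrank_eq_one hbr𝔩 hirr𝔩 (Submodule.neg_mem _ hι)
        ((neg_mul_neg ι ι).trans hιι) (P := Q') (Q := P') (fun x => by rw [hQ', LinearMap.neg_apply, neg_eq_iff_eq_neg])
        (fun x => by rw [hP', LinearMap.neg_apply, neg_inj]) (by omega) hfinP'
    · -- `(3 | 7)`
      exact UnitaryThreeCoprime.eq_top hbr𝔩 hirr𝔩 hι hιι hP' hQ' hfinP' (by omega) (s := fun x y : U => s (x : W) y)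
        (hsU U) (fun x y => hsymm x y) hP'Q' hdefP' hdefQ' hadj𝔩
    · -- `(7 | 3)`
      exact UnitaryThreeCoprime.eq_top' hbr𝔩 hirr𝔩 hι hιι hP' hQ' (by omega) (by omega)
        (s := fun x y : U => s (x : W) y) (hsU U) (fun x y => hsymm x y) hP'Q' hdefP' hdefQ' hadj𝔩
    · -- `(9 | 1)`
      exact UnitaryThreeCoprime.eq_top_of_finrank_eq_one hbr𝔩 hirr𝔩 hι hιι hP' hQ' (by omega) (by omega)
  -- `8 → 9` (triple route: `2(9 − ρ) ≠ 8ρ`)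
  have key8 : ∀ B' ∈ 𝔊, Θ * B' = B' → B' * Θ = -B' → Module.finrank ℂ (LinearMap.range B') = 8 → 𝔊 = ⊤ := by
    intro B' hB' hΘB' hB'Θ h8
    obtain ⟨B'', hB'', hΘB'', hB''Θ, hgt⟩ :=
      UnitaryRaisingRank.exists_raise_rank_gt_of_finrank_eq_succ_of_smul hbr hirr hΘ hΘΘ hP hQ hB' hΘB' hB'Θ
        (by omega) (by omega) (by omega) (fun ρ h1 h2 => by rw [h8] at h2; rw [h8, hQ10]; omega) hadd hsmul hsymm hPQ
        hdefP hdefQ hadj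
    have h9 := hle9 B'' hΘB''
    exact key B'' hB'' hΘB'' hB''Θ (by omega)
  -- STEP 2: otherwise every raising operator has rank in `{0, 2, 4, 5, 6}`
  by_contra hne
  have hbad : ∀ B' ∈ 𝔊, Θ * B' = B' → B' * Θ = -B' →
      Module.finrank ℂ (LinearMap.range B') = 0 ∨ Module.finrank ℂ (LinearMap.range B') = 2 ∨
        Module.finrank ℂ (LinearMap.range B') = 4 ∨ Module.finrank ℂ (LinearMap.range B') = 5 ∨
        Module.finrank ℂ (LinearMap.range B') = 6 := by
    intro B' hB' hΘB' hB'Θ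
    have h9 := hle9 B' hΘB'
    have hk : ¬ (Module.finrank ℂ (LinearMap.range B') = 1 ∨ Module.finrank ℂ (LinearMap.range B') = 3 ∨
        Module.finrank ℂ (LinearMap.range B') = 7 ∨ Module.finrank ℂ (LinearMap.range B') = 9) :=
      fun h => hne (key B' hB' hΘB' hB'Θ h)
    have hk8 : Module.finrank ℂ (LinearMap.range B') ≠ 8 := fun h => hne (key8 B' hB' hΘB' hB'Θ h)
    omega
  -- STEP 3: no `2`, then no `4`, `5`, then the constant-rank-`6` residual
  have hno2 : ∀ B ∈ 𝔊, Θ * B = B → B * Θ = -B → Module.finrank ℂ (LinearMap.range B) ≠ 2 :=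
    fun B hB hΘB hBΘ h2 => UnitaryNineTen.no_rank_two hbr hirr hΘ hΘΘ hP hQ hP9 hQ10 hadd hsymm hPQ hdefP hdefQ hadj
      hbad hB hΘB hBΘ h2
  have hbad₂ : ∀ B' ∈ 𝔊, Θ * B' = B' → B' * Θ = -B' →
      Module.finrank ℂ (LinearMap.range B') = 0 ∨ Module.finrank ℂ (LinearMap.range B') = 4 ∨
        Module.finrank ℂ (LinearMap.range B') = 5 ∨ Module.finrank ℂ (LinearMap.range B') = 6 := by
    intro B' hB' hΘB' hB'Θ
    have h2 := hno2 B' hB' hΘB' hB'Θ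
    rcases hbad B' hB' hΘB' hB'Θ with h | h | h | h | h <;> omega
  have hno4 : ∀ B ∈ 𝔊, Θ * B = B → B * Θ = -B → Module.finrank ℂ (LinearMap.range B) ≠ 4 :=
    fun B hB hΘB hBΘ h4 => UnitaryNineTen.no_rank_four hbr hirr hΘ hΘΘ hP hQ hP9 hadd hsymm hPQ hdefP hdefQ hadj hbad₂
      hB hΘB hBΘ h4
  have hno5 : ∀ B ∈ 𝔊, Θ * B = B → B * Θ = -B → Module.finrank ℂ (LinearMap.range B) ≠ 5 :=
    fun B hB hΘB hBΘ h5 => UnitaryNineTen.no_rank_five hbr hirr hΘ hΘΘ hP hQ hP9 hadd hsymm hPQ hdefP hdefQ hadj hbad₂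
      hB hΘB hBΘ h5
  have hbad₃ : ∀ B' ∈ 𝔊, Θ * B' = B' → B' * Θ = -B' →
      Module.finrank ℂ (LinearMap.range B') = 0 ∨ Module.finrank ℂ (LinearMap.range B') = 6 := by
    intro B' hB' hΘB' hB'Θ
    have h4 := hno4 B' hB' hΘB' hB'Θ
    have h5 := hno5 B' hB' hΘB' hB'Θ
    rcases hbad₂ B' hB' hΘB' hB'Θ with h | h | h | h <;> omega
  exact UnitaryNineTen.false_of_rank_zero_or_six hbr hirr hΘ hΘΘ hP hQ hP9 hQ10 hadd hsymm hPQ hdefP hdefQ hadj hbad₃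

/-- **The mirror core `(10, 9)`** (apply `eq_top_of_smul` to `−Θ`). [cite: Ribet1983, Thm. 3]
[cite: Gordon1997, Thm. 6.3 (3)] -/
theorem UnitaryNineTen.eq_top_of_smul' [FiniteDimensional ℂ W] {𝔊 : Submodule ℂ (Module.End ℂ W)}
    (hbr : ∀ Y ∈ 𝔊, ∀ Z ∈ 𝔊, Y * Z - Z * Y ∈ 𝔊)
    (hirr : ∀ U : Submodule ℂ W, (∀ A ∈ 𝔊, ∀ u ∈ U, A u ∈ U) → U = ⊥ ∨ U = ⊤)
    {Θ : Module.End ℂ W} (hΘ : Θ ∈ 𝔊) (hΘΘ : Θ * Θ = 1)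
    {P Q : Submodule ℂ W} (hP : ∀ x, x ∈ P ↔ Θ x = x) (hQ : ∀ x, x ∈ Q ↔ Θ x = -x)
    (hP10 : Module.finrank ℂ P = 10) (hQ9 : Module.finrank ℂ Q = 9)
    {s : W → W → ℂ} (hadd : ∀ x y z, s (x + y) z = s x z + s y z)
    (hsmul : ∀ (c : ℂ) (x y : W), s (c • x) y = c * s x y) (hsymm : ∀ x y, s y x = starRingEnd ℂ (s x y))
    (hPQ : ∀ p ∈ P, ∀ q ∈ Q, s p q = 0) (hdefP : ∀ p ∈ P, s p p = 0 → p = 0) (hdefQ : ∀ q ∈ Q, s q q = 0 → q = 0)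
    (hadj : ∀ X ∈ 𝔊, ∃ Y ∈ 𝔊, ∀ x y, s (X x) y = s x (Y y)) : 𝔊 = ⊤ := by
  have hnΘ : -Θ ∈ 𝔊 := Submodule.neg_mem _ hΘ
  have hnΘΘ : (-Θ) * (-Θ) = 1 := by rw [neg_mul_neg, hΘΘ]
  exact UnitaryNineTen.eq_top_of_smul hbr hirr hnΘ hnΘΘ (P := Q) (Q := P)
    (fun x => by rw [hQ, LinearMap.neg_apply, neg_eq_iff_eq_neg]) (fun x => by rw [hP, LinearMap.neg_apply, neg_inj])
    hQ9 hP10 hadd hsmul hsymm (fun p hp q hq => by rw [hsymm, hPQ q hq p hp, map_zero]) hdefQ hdefP hadj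

end HodgeStructure

end Literature.AlgebraicGeometry.Motives

end
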